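import Literature.Topology.FourManifolds.BranchedDoubleQuotient
import Mathlib.Analysis.Calculus.FDeriv.Prod
import Mathlib.Analysis.Calculus.FDeriv.Mul
import Mathlib.Analysis.Calculus.Deriv.Basic
import Mathlib.Analysis.Calculus.Deriv.Mul
import Mathlib.Analysis.Calculus.Deriv.Add
import Mathlib.Analysis.Calculus.Deriv.Prod
import Mathlib.Analysis.Calculus.Deriv.Comp
import Mathlib.Analysis.SpecialFunctions.Pow.Real
import Mathlib.Topology.Algebra.Module.FiniteDimension
import HarnessLib

/-!
# Calculus of the branched double model `(u, z) ↦ (u, z²)`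

Topic `Topology/FourManifolds`; namespace `Literature.Topology.FourManifolds.BranchedModel`. Second
file of the proof of `Literature.Topology.FourManifolds.DegtyarevKharlamov2000_conjQuotient_unique`
(`ConjugationQuotients.lean`); pure multivariable calculus and algebra, no manifolds. Everything
is proved; no named facts.

## Split coordinates

The tree's local model `branchedDoubleModel : (Fin 2 → ℂ) → ℝ⁴`,
`(v₀, v₁) ↦ (Re v₀, Re v₁, (Im v₀)² − (Im v₁)², 2 Im v₀ Im v₁)`, is the identity on the real
parts `u = (Re v₀, Re v₁)` and the complex squaring map on `z = Im v₀ + i Im v₁`. We fix the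
real-linear isomorphisms `split : (Fin 2 → ℂ) ≃L[ℝ] (Fin 2 → ℝ) × ℂ`, `v ↦ (u, z)`, and
`splitW : ℝ⁴ ≃L[ℝ] (Fin 2 → ℝ) × ℂ`, `w ↦ ((w₀, w₁), w₂ + i w₃)`, under which the model becomes
`sqModel (u, z) = (u, z²)` (`splitW_branchedDoubleModel`) and coordinatewise conjugation `star`
becomes `flipIm (u, z) = (u, -z)` (`split_star`). All later files compute in these coordinates.

## Descent to first order (`sq_normalDeriv_eq`)

If `θ` is a map of `(Fin 2 → ℝ) × ℂ` near a real point `(u, 0)` with `θ (u, 0) = (u', 0)` and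
`T ∘ sqModel = sqModel ∘ θ` near `(u, 0)`, both differentiable at the base points, then the
normal derivatives satisfy **`(DT (0, b²)).2 = ((Dθ (0, b)).2)²` for every `b`** (compare the
two second-order expansions of `t ↦ T (u, t² b²) = sqModel (θ (u, t b))`). Writing the real-linear
map `L = (Dθ (0, ·)).2` as `L b = α b + β b̄` (`conformalPart`, `anticonformalPart`), linearity of
`b² ↦ (L b)²` forces **`α β = 0`** (`conformalPart_mul_anticonformalPart_eq_zero`): the normal
derivative of a transition map between two adapted charts of ONE branched double quotient is
conformal or anticonformal, and the normal derivative of its descent is `w ↦ α² w` or `w ↦ β² w̄`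
(`sq_normalDeriv_apply`).

## The `2 × 2` lemma (`normSq_mixedCoeff_lt`)

For `|β| < |α|`, a unit complex number `e` and reals `a, t ≥ 0` not both zero, the real-linear
map `z ↦ P z + Q z̄`, `P = a (α/|α|)² e + t (α e + β ē) α`, `Q = t (α e + β ē) β`, is invertible:
`|Q|² < |P|²`. This is the pointwise invertibility, at the branch locus, of convex combinations
of the derivative of the comparison map (limit in the direction `e`) with the derivatives of the
explicit local solutions used in the sequel (module docstring of
`ConjugationQuotientsComparison.lean` and the seat notes).

## References

* A. Degtyarev, V. Kharlamov, Russian Math. Surveys 55 (2000), arXiv:math/0004134, §3.2 ¶1.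
  [DegtyarevKharlamov2000]
-/

noncomputable section

open scoped Topology ComplexConjugate ContDiff
open Set Function Filter Asymptotics

namespace Literature.Topology.FourManifolds

namespace BranchedModel

/-- Local notation: `𝕄` is the split model space `(Fin 2 → ℝ) × ℂ` of points `(u, z)`. -/
local notation "𝕄" => (Fin 2 → ℝ) × ℂ

/-! ### Split coordinates `(Fin 2 → ℂ) ≃ 𝕄` and `ℝ⁴ ≃ 𝕄` -/

/-- The split coordinates of `ℂ²`: `(v₀, v₁) ↦ ((Re v₀, Re v₁), Im v₀ + i Im v₁)` — the real
locus `Fix star` becomes `(Fin 2 → ℝ) × {0}` and the "imaginary plane", on which `star` acts by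
`-1`, becomes the factor `ℂ`. A real-linear isomorphism. [folklore] -/
def split : (Fin 2 → ℂ) ≃L[ℝ] 𝕄 :=
  LinearEquiv.toContinuousLinearEquiv
    { toFun := fun v => (fun i => (v i).re, ⟨(v 0).im, (v 1).im⟩)
      invFun := fun x => ![⟨x.1 0, x.2.re⟩, ⟨x.1 1, x.2.im⟩]
      map_add' := fun v v' =>
        Prod.ext (funext fun i => by simp) (Complex.ext (by simp) (by simp))
      map_smul' := fun c v =>
        Prod.ext (funext fun i => by simp) (Complex.ext (by simp) (by simp))
      left_inv := fun v => by
        funext i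
        fin_cases i <;> simp
      right_inv := fun x =>
        Prod.ext (funext fun i => by fin_cases i <;> simp) (Complex.ext (by simp) (by simp)) }

/-- The components of `split v`. [folklore] -/
@[simp]
theorem split_apply (v : Fin 2 → ℂ) :
    split v = (fun i => (v i).re, (⟨(v 0).im, (v 1).im⟩ : ℂ)) :=
  rfl

/-- The inverse of `split`. [folklore] -/
@[simp]
theorem split_symm_apply (x : 𝕄) :
    split.symm x = ![(⟨x.1 0, x.2.re⟩ : ℂ), ⟨x.1 1, x.2.im⟩] :=
  rfl

/-- The split coordinates of `ℝ⁴`: `w ↦ ((w₀, w₁), w₂ + i w₃)`. A real-linear isomorphism.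
[folklore] -/
def splitW : EuclideanSpace ℝ (Fin 4) ≃L[ℝ] 𝕄 :=
  LinearEquiv.toContinuousLinearEquiv
    { toFun := fun w => (![w 0, w 1], ⟨w 2, w 3⟩)
      invFun := fun x => WithLp.toLp 2 ![x.1 0, x.1 1, x.2.re, x.2.im]
      map_add' := fun w w' =>
        Prod.ext (funext fun i => by fin_cases i <;> simp) (Complex.ext (by simp) (by simp))
      map_smul' := fun c w =>
        Prod.ext (funext fun i => by fin_cases i <;> simp) (Complex.ext (by simp) (by simp))
      left_inv := fun w => by
        ext i
        fin_cases i <;> simp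
      right_inv := fun x =>
        Prod.ext (funext fun i => by fin_cases i <;> simp) (Complex.ext (by simp) (by simp)) }

/-- The components of `splitW w`. [folklore] -/
@[simp]
theorem splitW_apply (w : EuclideanSpace ℝ (Fin 4)) :
    splitW w = (![w 0, w 1], (⟨w 2, w 3⟩ : ℂ)) :=
  rfl

/-- The inverse of `splitW`. [folklore] -/
@[simp]
theorem splitW_symm_apply (x : 𝕄) :
    splitW.symm x = WithLp.toLp 2 ![x.1 0, x.1 1, x.2.re, x.2.im] :=
  rfl

/-- **The branched double model in split coordinates**: `(u, z) ↦ (u, z²)`. [folklore] -/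
def sqModel (x : 𝕄) : 𝕄 :=
  (x.1, x.2 ^ 2)

/-- Unfolding lemma for `sqModel`. [folklore] -/
@[simp]
theorem sqModel_apply (u : Fin 2 → ℝ) (z : ℂ) : sqModel (u, z) = (u, z ^ 2) :=
  rfl

/-- The involution `(u, z) ↦ (u, -z)` of the split model (coordinatewise conjugation `star` of
`ℂ²` read in split coordinates, `split_star`). [folklore] -/
def flipIm : 𝕄 ≃L[ℝ] 𝕄 :=
  LinearEquiv.toContinuousLinearEquiv
    ({ toFun := fun x => (x.1, -x.2)
       invFun := fun x => (x.1, -x.2)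
       map_add' := fun x y => Prod.ext (by simp) (by simp; ring)
       map_smul' := fun c x => Prod.ext (by simp) (by simp)
       left_inv := fun x => by simp
       right_inv := fun x => by simp } : 𝕄 ≃ₗ[ℝ] 𝕄)

/-- Unfolding lemma for `flipIm`. [folklore] -/
@[simp]
theorem flipIm_apply (x : 𝕄) : flipIm x = (x.1, -x.2) :=
  rfl

/-- `flipIm` is an involution. [folklore] -/
@[simp]
theorem flipIm_flipIm (x : 𝕄) : flipIm (flipIm x) = x := by
  simp

/-- The model is `flipIm`-invariant. [folklore] -/
@[simp]
theorem sqModel_flipIm (x : 𝕄) : sqModel (flipIm x) = sqModel x := by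
  simp [sqModel]

/-- **`star` in split coordinates is `flipIm`.** [folklore] -/
@[simp]
theorem split_star (v : Fin 2 → ℂ) : split (star v) = flipIm (split v) :=
  Prod.ext (funext fun i => by simp) (Complex.ext (by simp) (by simp))

/-- **The branched double model in split coordinates**:
`splitW ∘ branchedDoubleModel = sqModel ∘ split`. [folklore] -/
@[simp]
theorem splitW_branchedDoubleModel (v : Fin 2 → ℂ) :
    splitW (branchedDoubleModel v) = sqModel (split v) := by
  simp only [splitW_apply, split_apply, sqModel_apply, Prod.mk.injEq]
  refine ⟨?_, ?_⟩
  · funext i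
    fin_cases i <;> simp [branchedDoubleModel_apply]
  · apply Complex.ext
    · simp [branchedDoubleModel_apply, sq, Complex.mul_re]
    · simp [branchedDoubleModel_apply, sq, Complex.mul_im]
      ring

/-- The model as a conjugate: `branchedDoubleModel = splitW⁻¹ ∘ sqModel ∘ split`. [folklore] -/
theorem branchedDoubleModel_eq (v : Fin 2 → ℂ) :
    branchedDoubleModel v = splitW.symm (sqModel (split v)) := by
  rw [← splitW_branchedDoubleModel, ContinuousLinearEquiv.symm_apply_apply]

/-! ### Calculus of `sqModel` -/

/-- The derivative of `sqModel` at `(u, z)`: `(a, b) ↦ (a, 2 z b)`. [folklore] -/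
def sqModelDeriv (z : ℂ) : 𝕄 →L[ℝ] 𝕄 :=
  (ContinuousLinearMap.fst ℝ (Fin 2 → ℝ) ℂ).prod
    ((2 * z) • (ContinuousLinearMap.snd ℝ (Fin 2 → ℝ) ℂ))

/-- Unfolding lemma for `sqModelDeriv`. [folklore] -/
@[simp]
theorem sqModelDeriv_apply (z : ℂ) (y : 𝕄) :
    sqModelDeriv z y = (y.1, 2 * z * y.2) := by
  simp [sqModelDeriv, smul_eq_mul]

/-- `sqModel` has derivative `sqModelDeriv z` at `(u, z)`. [folklore] -/
theorem hasFDerivAt_sqModel (x : 𝕄) :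
    HasFDerivAt sqModel (sqModelDeriv x.2) x := by
  have h1 : HasFDerivAt (fun y : 𝕄 => y.1) (ContinuousLinearMap.fst ℝ _ _) x :=
    hasFDerivAt_fst
  have h2 : HasFDerivAt (fun y : 𝕄 => y.2 ^ 2)
      ((2 * x.2) • ContinuousLinearMap.snd ℝ (Fin 2 → ℝ) ℂ) x := by
    have hs : HasFDerivAt (fun y : 𝕄 => y.2) (ContinuousLinearMap.snd ℝ _ _) x :=
      hasFDerivAt_snd
    refine (hs.pow 2).congr_fderiv ?_
    ext y <;> simp [two_mul]
  exact h1.prodMk h2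

/-- `sqModel` is `C^∞`. [folklore] -/
theorem contDiff_sqModel : ContDiff ℝ ∞ sqModel :=
  contDiff_fst.prodMk (contDiff_snd.pow 2)

/-- `sqModel` is continuous. [folklore] -/
theorem continuous_sqModel : Continuous sqModel :=
  contDiff_sqModel.continuous

/-- The fibres of `sqModel` are the `flipIm`-orbits. [folklore] -/
theorem sqModel_eq_iff (x y : 𝕄) :
    sqModel x = sqModel y ↔ y = x ∨ y = flipIm x := by
  rcases x with ⟨u, z⟩
  rcases y with ⟨u', z'⟩
  simp only [sqModel_apply, flipIm_apply, Prod.mk.injEq]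
  constructor
  · rintro ⟨hu, h⟩
    rcases sq_eq_sq_iff_eq_or_eq_neg.1 h.symm with h' | h'
    · exact Or.inl ⟨hu.symm, h'⟩
    · exact Or.inr ⟨hu.symm, h'⟩
  · rintro (⟨hu, hz⟩ | ⟨hu, hz⟩)
    · exact ⟨hu.symm, by rw [hz]⟩
    · exact ⟨hu.symm, by rw [hz]; ring⟩

/-! ### Normal parts of linear maps of `𝕄` and the conformal / anticonformal split of `ℂ →L[ℝ] ℂ` -/

/-- The **normal part** `b ↦ (A (0, b)).2` of a real-linear map `A` of the split model: its
`ℂ → ℂ` block. For the derivative at a real point `(u, 0)` of a `flipIm`-equivariant map this is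
the normal derivative along the real locus. [folklore] -/
def normalPart (A : 𝕄 →L[ℝ] 𝕄) : ℂ →L[ℝ] ℂ :=
  (ContinuousLinearMap.snd ℝ (Fin 2 → ℝ) ℂ).comp (A.comp (ContinuousLinearMap.inr ℝ (Fin 2 → ℝ) ℂ))

/-- Unfolding lemma for `normalPart`. [folklore] -/
@[simp]
theorem normalPart_apply (A : 𝕄 →L[ℝ] 𝕄) (b : ℂ) : normalPart A b = (A (0, b)).2 :=
  rfl

/-- The **conformal coefficient** `α = (L 1 - i L i)/2` of a real-linear `L : ℂ → ℂ`, so that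
`L b = α b + β b̄` (`apply_eq_conformalPart_add`). [folklore] -/
def conformalPart (L : ℂ →L[ℝ] ℂ) : ℂ :=
  (L 1 - Complex.I * L Complex.I) / 2

/-- The **anticonformal coefficient** `β = (L 1 + i L i)/2` of a real-linear `L : ℂ → ℂ`.
[folklore] -/
def anticonformalPart (L : ℂ →L[ℝ] ℂ) : ℂ :=
  (L 1 + Complex.I * L Complex.I) / 2

/-- **Every real-linear self-map of `ℂ` is `b ↦ α b + β b̄`** with `α`, `β` its conformal and
anticonformal coefficients. [folklore] -/
theorem apply_eq_conformalPart_add (L : ℂ →L[ℝ] ℂ) (b : ℂ) :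
    L b = conformalPart L * b + anticonformalPart L * conj b := by
  have hb : b = b.re • (1 : ℂ) + b.im • Complex.I := by
    simp
  conv_lhs => rw [hb, map_add, map_smul, map_smul]
  simp only [conformalPart, anticonformalPart, Complex.real_smul]
  apply Complex.ext
  · simp [Complex.mul_re, Complex.mul_im, Complex.div_ofNat_re]
    ring
  · simp [Complex.mul_re, Complex.mul_im, Complex.div_ofNat_im]
    ring

/-! ### Descent to first order along the real locus -/

/-- A constant multiple of `t²` which is `o(t²)` at `0` vanishes. [folklore] -/
theorem eq_zero_of_isLittleO_sq_mul {c : ℂ}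
    (h : (fun t : ℝ => ((t : ℂ) ^ 2) * c) =o[𝓝 0] fun t : ℝ => t ^ 2) : c = 0 := by
  by_contra hc
  have hpos : 0 < ‖c‖ / 2 := half_pos (norm_pos_iff.2 hc)
  have hev := h.def hpos
  have hev' : ∀ᶠ t : ℝ in 𝓝[>] 0, ‖((t : ℂ) ^ 2) * c‖ ≤ ‖c‖ / 2 * ‖t ^ 2‖ :=
    hev.filter_mono nhdsWithin_le_nhds
  obtain ⟨t, ht, htpos⟩ := (hev'.and self_mem_nhdsWithin).exists
  have ht2 : 0 < t ^ 2 := by positivity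
  rw [norm_mul, norm_pow, Complex.norm_real, Real.norm_eq_abs, abs_of_pos (mem_Ioi.1 htpos),
    Real.norm_eq_abs, abs_of_pos ht2] at ht
  have : ‖c‖ ≤ ‖c‖ / 2 := le_of_mul_le_mul_left (by linarith [ht]) ht2
  linarith [norm_pos_iff.2 hc]

/-- **Descent to first order.** Let `θ` and `T` be maps of the split model with
`T ∘ sqModel = sqModel ∘ θ` near a real point `(u, 0)`, `θ (u, 0)` real, `θ` differentiable at
`(u, 0)` and `T` at `sqModel (u, 0) = (u, 0)`. Then for every `b : ℂ`
**`(DT (0, b²)).2 = ((Dθ (0, b)).2)²`**: both sides are the coefficient of `t²` in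
`t ↦ (T (u, t² b²)).2 = ((θ (u, t b)).2)²`. [folklore] -/
theorem sq_normalDeriv_eq {θ T : 𝕄 → 𝕄} {u : Fin 2 → ℝ} {θ' T' : 𝕄 →L[ℝ] 𝕄}
    (hθ : HasFDerivAt θ θ' (u, 0)) (hθ0 : (θ (u, 0)).2 = 0)
    (hT : HasFDerivAt T T' (u, 0))
    (hrel : ∀ᶠ x in 𝓝 ((u, 0) : 𝕄), T (sqModel x) = sqModel (θ x)) (b : ℂ) :
    normalPart T' (b ^ 2) = (normalPart θ' b) ^ 2 := by
  -- the two curves through the base point and their first-order expansions in `ℂ`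
  set L : ℂ := normalPart θ' b with hL
  set K : ℂ := normalPart T' (b ^ 2) with hK
  set c₁ : ℝ → 𝕄 := fun t => ((u, 0) : 𝕄) + t • ((0, b) : 𝕄) with hc₁def
  set c₂ : ℝ → 𝕄 := fun s => ((u, 0) : 𝕄) + s • ((0, b ^ 2) : 𝕄) with hc₂def
  set g₁ : ℝ → ℂ := fun t => (θ (c₁ t)).2 with hg₁
  set g₂ : ℝ → ℂ := fun s => (T (c₂ s)).2 with hg₂
  have hc₁0 : c₁ 0 = (u, 0) := by simp [hc₁def]
  have hc₂0 : c₂ 0 = (u, 0) := by simp [hc₂def]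
  have hc₁ : HasDerivAt c₁ ((0, b) : 𝕄) 0 := by
    have h := ((hasDerivAt_id (0 : ℝ)).smul_const ((0, b) : 𝕄)).const_add ((u, 0) : 𝕄)
    simpa [hc₁def] using h
  have hc₂ : HasDerivAt c₂ ((0, b ^ 2) : 𝕄) 0 := by
    have h := ((hasDerivAt_id (0 : ℝ)).smul_const ((0, b ^ 2) : 𝕄)).const_add ((u, 0) : 𝕄)
    simpa [hc₂def] using h
  -- derivatives of `g₁`, `g₂` at `0`
  have hθc : HasFDerivAt θ θ' (c₁ 0) := by rw [hc₁0]; exact hθ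
  have hTc : HasFDerivAt T T' (c₂ 0) := by rw [hc₂0]; exact hT
  have hg₁' : HasDerivAt g₁ L 0 := by
    have h2 := hasFDerivAt_snd.comp_hasDerivAt (0 : ℝ) (hθc.comp_hasDerivAt (0 : ℝ) hc₁)
    simpa [hg₁, hL, Function.comp_def] using h2
  have hg₂' : HasDerivAt g₂ K 0 := by
    have h2 := hasFDerivAt_snd.comp_hasDerivAt (0 : ℝ) (hTc.comp_hasDerivAt (0 : ℝ) hc₂)
    simpa [hg₂, hK, Function.comp_def] using h2
  -- values at `0`
  have hg₁0 : g₁ 0 = 0 := by simp only [hg₁, hc₁0]; exact hθ0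
  have hT0 : (T (u, 0)).2 = 0 := by
    have h := hrel.self_of_nhds
    have hsq : sqModel ((u, 0) : 𝕄) = (u, 0) := by simp [sqModel]
    rw [hsq] at h
    rw [h]
    simp [sqModel, hθ0]
  have hg₂0 : g₂ 0 = 0 := by simp only [hg₂, hc₂0]; exact hT0
  -- first-order remainders
  have hr₁ : (fun t : ℝ => g₁ t - (t : ℂ) * L) =o[𝓝 0] fun t : ℝ => t := by
    have h := (hasDerivAt_iff_isLittleO_nhds_zero.1 hg₁')
    refine h.congr' (Eventually.of_forall fun t => ?_) (Eventually.of_forall fun t => rfl)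
    simp [hg₁0, Complex.real_smul]
  have hr₂ : (fun t : ℝ => g₂ (t ^ 2) - ((t : ℂ) ^ 2) * K) =o[𝓝 0] fun t : ℝ => t ^ 2 := by
    have h := (hasDerivAt_iff_isLittleO_nhds_zero.1 hg₂')
    have ht : Tendsto (fun t : ℝ => t ^ 2) (𝓝 0) (𝓝 0) := by
      simpa using ((continuous_pow 2).tendsto (0 : ℝ))
    have h' := h.comp_tendsto ht
    refine h'.congr' (Eventually.of_forall fun t => ?_) (Eventually.of_forall fun t => rfl)
    simp [Function.comp, hg₂0, Complex.real_smul]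
  -- the relation along the curve: `g₂ (t²) = (g₁ t)²` near `t = 0`
  have hrel' : ∀ᶠ t : ℝ in 𝓝 0, g₂ (t ^ 2) = (g₁ t) ^ 2 := by
    have ht : Tendsto c₁ (𝓝 0) (𝓝 ((u, 0) : 𝕄)) := by
      simpa [hc₁0] using hc₁.continuousAt.tendsto
    filter_upwards [ht.eventually hrel] with t hx
    have hsq : sqModel (c₁ t) = c₂ (t ^ 2) := by
      apply Prod.ext
      · simp [hc₁def, hc₂def, sqModel]
      · simp [hc₁def, hc₂def, sqModel, Complex.real_smul]
        ring
    simp only [hg₂, hg₁]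
    rw [← hsq, hx]
    simp [sqModel]
  -- compare the two expansions
  have hdiff : (fun t : ℝ => ((t : ℂ) ^ 2) * (K - L ^ 2)) =o[𝓝 0] fun t : ℝ => t ^ 2 := by
    have hO : (fun t : ℝ => g₁ t - (t : ℂ) * L + 2 * ((t : ℂ) * L)) =O[𝓝 0] fun t : ℝ => t := by
      refine (hr₁.isBigO.add ?_)
      refine IsBigO.of_bound (2 * ‖L‖) (Eventually.of_forall fun t => ?_)
      simp only [norm_mul, Complex.norm_real, Real.norm_eq_abs, Complex.norm_ofNat]
      nlinarith [norm_nonneg L, abs_nonneg t]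
    have hprod := (hr₁.mul_isBigO hO).congr (fun _ => rfl) (fun t => (pow_two t).symm)
    have hsum := hprod.sub hr₂
    refine hsum.congr' ?_ (Eventually.of_forall fun t => rfl)
    filter_upwards [hrel'] with t ht
    rw [ht]
    ring
  exact sub_eq_zero.1 (eq_zero_of_isLittleO_sq_mul hdiff)

/-- **Linearity of the squared normal derivative forces (anti)conformality.** If two
real-linear maps `K, L : ℂ → ℂ` satisfy `K (b²) = (L b)²` for all `b`, then, writing
`L b = α b + β b̄`, we have `α β = 0`. [folklore] -/
theorem conformalPart_mul_anticonformalPart_eq_zero {K L : ℂ →L[ℝ] ℂ}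
    (h : ∀ b : ℂ, K (b ^ 2) = (L b) ^ 2) :
    conformalPart L * anticonformalPart L = 0 := by
  have h1 := h 1
  have hI := h Complex.I
  rw [one_pow] at h1
  rw [Complex.I_sq, map_neg] at hI
  rw [apply_eq_conformalPart_add L] at h1 hI
  rw [map_one (starRingEnd ℂ), mul_one, mul_one] at h1
  rw [Complex.conj_I] at hI
  -- `K 1 = (α + β)²` and `-K 1 = (α i - β i)²`
  have key : (conformalPart L + anticonformalPart L) ^ 2 =
      -((conformalPart L * Complex.I + anticonformalPart L * -Complex.I) ^ 2) := by
    rw [← h1, ← hI, neg_neg]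
  have h4 : (4 : ℂ) * (conformalPart L * anticonformalPart L) = 0 := by
    linear_combination key - (conformalPart L - anticonformalPart L) ^ 2 * Complex.I_sq
  simpa using h4

/-- Under the same hypothesis, **the squared normal derivative is `w ↦ α² w + β² w̄`**.
[folklore] -/
theorem sq_normalDeriv_apply {K L : ℂ →L[ℝ] ℂ} (h : ∀ b : ℂ, K (b ^ 2) = (L b) ^ 2) (w : ℂ) :
    K w = conformalPart L ^ 2 * w + anticonformalPart L ^ 2 * conj w := by
  set α := conformalPart L with hα
  set β := anticonformalPart L with hβ
  have hαβ : α * β = 0 := conformalPart_mul_anticonformalPart_eq_zero h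
  have h1 : K 1 = α ^ 2 + β ^ 2 := by
    have h1 := h 1
    rw [one_pow, apply_eq_conformalPart_add L, map_one (starRingEnd ℂ), mul_one, mul_one] at h1
    rw [h1]
    linear_combination (2 : ℂ) * hαβ
  -- `b = 1 + i`, `b² = 2i`
  have h2 : K Complex.I = (α ^ 2 - β ^ 2) * Complex.I := by
    have h2 := h (1 + Complex.I)
    rw [apply_eq_conformalPart_add L, map_add, map_one (starRingEnd ℂ), Complex.conj_I] at h2
    have hsq : (1 + Complex.I) ^ 2 = (2 : ℝ) • Complex.I := by
      rw [Complex.real_smul]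
      push_cast
      linear_combination Complex.I_sq
    rw [hsq, map_smul, Complex.real_smul] at h2
    push_cast at h2
    have h2' : (2 : ℂ) * K Complex.I = 2 * ((α ^ 2 - β ^ 2) * Complex.I) := by
      linear_combination h2 + (α ^ 2 + β ^ 2) * Complex.I_sq + 2 * (1 - Complex.I ^ 2) * hαβ
    exact mul_left_cancel₀ two_ne_zero h2'
  have hw : w = w.re • (1 : ℂ) + w.im • Complex.I := by
    simp
  conv_lhs => rw [hw, map_add, map_smul, map_smul, h1, h2]
  simp only [Complex.real_smul]
  apply Complex.ext
  · simp [Complex.mul_re, Complex.mul_im, sq]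
    ring
  · simp [Complex.mul_re, Complex.mul_im, sq]
    ring

/-! ### The `2 × 2` lemma -/

/-- **Abstract `2 × 2` lemma.** Complex numbers with `Re(ε̄ p) > 0`, `Re(v̄ q) ≥ c |v|²` for
some `c > 0`, reals `a, t ≥ 0` not both zero, and `a ε v + t p q = 0` force `v = 0`: for `t = 0`
this is `a ε v = 0`; for `t > 0` the relation says `q = μ v` with `Re μ ≤ 0`, contradicting
`Re(v̄ q) > 0`. (With `p = Sε`, `q = Sv` for a positive self-adjoint `S`: `α + t m_ζ S` has no
kernel.) [folklore] -/
theorem eq_zero_of_pos_of_rel {ε v p q : ℂ} {a t c : ℝ} (hεp : 0 < (conj ε * p).re)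
    (hc : 0 < c) (hvq : c * ‖v‖ ^ 2 ≤ (conj v * q).re) (ha : 0 ≤ a) (ht : 0 ≤ t)
    (hat : 0 < a + t) (hZ : (a : ℂ) * (ε * v) + t * (p * q) = 0) : v = 0 := by
  by_contra hv
  have hv2 : 0 < ‖v‖ ^ 2 := by positivity
  have hε : ε ≠ 0 := by
    rintro rfl
    simp at hεp
  have hp : p ≠ 0 := by
    rintro rfl
    simp at hεp
  rcases ht.eq_or_lt with rfl | htpos
  · -- `t = 0`: `a ε v = 0` with `a > 0`
    have ha' : (a : ℂ) ≠ 0 := by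
      have : 0 < a := by simpa using hat
      exact_mod_cast this.ne'
    simp only [Complex.ofReal_zero, zero_mul, add_zero, mul_eq_zero, ha', hε, hv,
      or_self] at hZ
  · -- `t > 0`: `q = -(a/t) (ε/p) v`
    have ht' : (t : ℂ) ≠ 0 := by exact_mod_cast htpos.ne'
    have hq : q = -((a : ℂ) / t) * (ε / p) * v := by
      field_simp
      linear_combination hZ
    have hvv : conj v * v = (‖v‖ : ℂ) ^ 2 := by
      rw [mul_comm, Complex.mul_conj, Complex.normSq_eq_norm_sq, Complex.ofReal_pow]
    -- `Re(v̄ q) = -(a/t) |v|² Re(ε/p) ≤ 0`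
    have hre : (conj v * q).re = -(a / t) * ‖v‖ ^ 2 * ((conj ε * p).re / Complex.normSq p) := by
      have h1 : conj v * q = ((-(a / t) * ‖v‖ ^ 2 : ℝ) : ℂ) * (ε / p) := by
        rw [hq]
        push_cast
        linear_combination (-(a : ℂ) / t * (ε / p)) * hvv
      have h2 : (ε / p).re = (conj ε * p).re / Complex.normSq p := by
        rw [Complex.div_re, Complex.mul_re, Complex.conj_re, Complex.conj_im]
        ring
      rw [h1, Complex.re_ofReal_mul, h2]
    have hnonpos : (conj v * q).re ≤ 0 := by
      rw [hre]
      have h3 : 0 < Complex.normSq p := Complex.normSq_pos.2 hp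
      have h4 : 0 ≤ (conj ε * p).re / Complex.normSq p := div_nonneg hεp.le h3.le
      have h5 : 0 ≤ a / t * ‖v‖ ^ 2 := by positivity
      nlinarith [mul_nonneg h5 h4]
    have : c * ‖v‖ ^ 2 ≤ 0 := hvq.trans hnonpos
    nlinarith

/-- **Positivity of `x ↦ r x + γ x̄`**: `Re(x̄ (r x + γ x̄)) ≥ (r - |γ|) |x|²`. [folklore] -/
theorem re_conj_mul_add_ge (r : ℝ) (γ x : ℂ) :
    (r - ‖γ‖) * ‖x‖ ^ 2 ≤ (conj x * (r * x + γ * conj x)).re := by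
  have hxx : conj x * x = (‖x‖ : ℂ) ^ 2 := by
    rw [mul_comm, Complex.mul_conj, Complex.normSq_eq_norm_sq, Complex.ofReal_pow]
  have h1 : (conj x * (r * x + γ * conj x)).re = r * ‖x‖ ^ 2 + (γ * (conj x * conj x)).re := by
    have : conj x * (r * x + γ * conj x) = ((r * ‖x‖ ^ 2 : ℝ) : ℂ) + γ * (conj x * conj x) := by
      push_cast
      linear_combination (r : ℂ) * hxx
    rw [this, Complex.add_re, Complex.ofReal_re]
  have h2 : -(‖γ‖ * ‖x‖ ^ 2) ≤ (γ * (conj x * conj x)).re := by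
    have h := Complex.abs_re_le_norm (γ * (conj x * conj x))
    have hn : ‖γ * (conj x * conj x)‖ = ‖γ‖ * ‖x‖ ^ 2 := by
      rw [norm_mul, norm_mul, Complex.norm_conj, sq]
    rw [hn] at h
    exact (abs_le.1 h).1
  rw [h1]
  nlinarith

/-- **The squared unitary polar factor** `Ô` of an invertible real-linear `L : ℂ → ℂ`, `L b =
α b + β b̄`: the LINEAR map `w ↦ (α/|α|)² w` when `|β| < |α|` (orientation-preserving `L`, unitary
polar factor the rotation `α/|α|`) and `w ↦ (β/|β|)² w̄` otherwise (unitary factor the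
reflection `b ↦ (β/|β|) b̄`); in both cases `Ô w = (O √w)²`. It is the normal derivative at the
branch locus of the explicit local solutions of the uniqueness proof. [folklore] -/
def polarSq (L : ℂ →L[ℝ] ℂ) : ℂ →L[ℝ] ℂ :=
  if ‖anticonformalPart L‖ < ‖conformalPart L‖ then
    (conformalPart L / ‖conformalPart L‖) ^ 2 • ContinuousLinearMap.id ℝ ℂ
  else
    (anticonformalPart L / ‖anticonformalPart L‖) ^ 2 • (Complex.conjCLE : ℂ →L[ℝ] ℂ)

/-- `polarSq` in the orientation-preserving case. [folklore] -/
theorem polarSq_apply_of_lt {L : ℂ →L[ℝ] ℂ} (h : ‖anticonformalPart L‖ < ‖conformalPart L‖)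
    (w : ℂ) : polarSq L w = (conformalPart L / ‖conformalPart L‖) ^ 2 * w := by
  simp [polarSq, h]

/-- `polarSq` in the orientation-reversing case. [folklore] -/
theorem polarSq_apply_of_not_lt {L : ℂ →L[ℝ] ℂ} (h : ¬ ‖anticonformalPart L‖ < ‖conformalPart L‖)
    (w : ℂ) : polarSq L w = (anticonformalPart L / ‖anticonformalPart L‖) ^ 2 * conj w := by
  simp [polarSq, h]

/-- **The directional normal derivative of the comparison map**: for a real-linear `L : ℂ → ℂ`
and a direction `e ≠ 0`, the linear map `y ↦ (L e) · L (y / e)` — the limit, as `w → 0` in the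
direction `e²`, of the derivative of `w ↦ (L √w)²`. [folklore] -/
def dirNormal (L : ℂ →L[ℝ] ℂ) (e : ℂ) : ℂ →L[ℝ] ℂ :=
  L e • L.comp (e⁻¹ • ContinuousLinearMap.id ℝ ℂ)

/-- Unfolding lemma for `dirNormal`. [folklore] -/
@[simp]
theorem dirNormal_apply (L : ℂ →L[ℝ] ℂ) (e y : ℂ) : dirNormal L e y = L e * L (e⁻¹ * y) := by
  simp [dirNormal, smul_eq_mul]

/-- **The `2 × 2` lemma.** For an invertible real-linear `L : ℂ → ℂ` (`|α| ≠ |β|`), a unit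
direction `e` and reals `a, t ≥ 0` not both zero, the convex-type combination
`a Ô + t · dirNormal L e` is injective. (After the substitution `ε = O e`, `v = O (y/e)` it reads
`a ε v + t (Sε)(Sv)` with `S = L O⁻¹`, `Re(x̄ S x) ≥ (|α| - |β|)|x|²`, and
`eq_zero_of_pos_of_rel` applies.) [folklore] -/
theorem injective_smul_polarSq_add_smul_dirNormal (L : ℂ →L[ℝ] ℂ)
    (hL : ‖conformalPart L‖ ≠ ‖anticonformalPart L‖) {e : ℂ} (he : ‖e‖ = 1) {a t : ℝ}
    (ha : 0 ≤ a) (ht : 0 ≤ t) (hat : 0 < a + t) :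
    Injective (a • polarSq L + t • dirNormal L e) := by
  set α := conformalPart L with hα
  set β := anticonformalPart L with hβ
  have he0 : e ≠ 0 := by
    rintro rfl
    simp at he
  rw [injective_iff_map_eq_zero]
  intro y hy
  rw [add_apply, smul_apply,
    smul_apply, dirNormal_apply, apply_eq_conformalPart_add L e,
    apply_eq_conformalPart_add L (e⁻¹ * y)] at hy
  set y' := e⁻¹ * y with hy'
  simp only [← hα, ← hβ, Complex.real_smul] at hy
  have hyy : y = e * y' := by rw [hy']; field_simp
  rcases lt_or_gt_of_ne hL with hlt | hlt
  · -- orientation-reversing case `|α| < |β|`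
    rw [polarSq_apply_of_not_lt (not_lt.2 hlt.le)] at hy
    simp only [← hβ] at hy
    have hβ0 : β ≠ 0 := by
      rintro h0
      rw [h0, norm_zero] at hlt
      exact absurd hlt (not_lt.2 (norm_nonneg α))
    set s : ℝ := ‖β‖ with hs
    have hs0 : (s : ℂ) ≠ 0 := by exact_mod_cast (norm_ne_zero_iff.2 hβ0)
    set om := β / (s : ℂ) with hom
    have hβom : β = (s : ℂ) * om := by rw [hom]; field_simp
    have homn : ‖om‖ = 1 := by
      rw [hom, norm_div, Complex.norm_real, Real.norm_eq_abs, hs, abs_norm,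
        div_self (norm_ne_zero_iff.2 hβ0)]
    have hom0 : om ≠ 0 := fun h0 => by rw [h0, norm_zero] at homn; exact zero_ne_one homn
    have hconjom : conj om = om⁻¹ := by
      refine eq_inv_of_mul_eq_one_left ?_
      rw [mul_comm, Complex.mul_conj, Complex.normSq_eq_norm_sq, homn]; simp
    -- the substitution `ε = om ē`, `v = om ȳ'`, `S x = s x + α om x̄`
    obtain ⟨ε, hε⟩ : ∃ ε : ℂ, ε = om * conj e := ⟨_, rfl⟩
    obtain ⟨v, hv⟩ : ∃ v : ℂ, v = om * conj y' := ⟨_, rfl⟩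
    have hec : e = om * conj ε := by
      rw [hε, map_mul, Complex.conj_conj, hconjom, ← mul_assoc, mul_inv_cancel₀ hom0, one_mul]
    have hy'c : y' = om * conj v := by
      rw [hv, map_mul, Complex.conj_conj, hconjom, ← mul_assoc, mul_inv_cancel₀ hom0, one_mul]
    have hconje : conj e = om⁻¹ * ε := by rw [hε, ← mul_assoc, inv_mul_cancel₀ hom0, one_mul]
    have hconjy' : conj y' = om⁻¹ * v := by rw [hv, ← mul_assoc, inv_mul_cancel₀ hom0, one_mul]
    have hS : ∀ x : ℂ, (s - ‖α‖) * ‖x‖ ^ 2 ≤ (conj x * ((s : ℂ) * x + (α * om) * conj x)).re :=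
      fun x => by
        have h := re_conj_mul_add_ge s (α * om) x
        rwa [norm_mul, homn, mul_one] at h
    have hεp : 0 < (conj ε * ((s : ℂ) * ε + (α * om) * conj ε)).re := by
      have h := hS ε
      have hεn : ‖ε‖ = 1 := by rw [hε, norm_mul, Complex.norm_conj, he, homn, mul_one]
      rw [hεn] at h
      have : 0 < s - ‖α‖ := sub_pos.2 hlt
      nlinarith
    have hv0 : v = 0 := by
      refine eq_zero_of_pos_of_rel (a := a) (t := t) (c := s - ‖α‖) hεp (sub_pos.2 hlt) (hS v)
        ha ht hat ?_
      have key : (a : ℂ) * (ε * v) + t * (((s : ℂ) * ε + (α * om) * conj ε) *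
          ((s : ℂ) * v + (α * om) * conj v)) =
          (a : ℂ) * (om ^ 2 * conj y) + t * ((α * e + β * conj e) * (α * y' + β * conj y')) := by
        rw [hyy, map_mul, hconje, hconjy', hec, hy'c, hβom]
        field_simp
        ring
      rw [key]
      exact hy
    have hy'0 : y' = 0 := by rw [hy'c, hv0, map_zero, mul_zero]
    rw [hyy, hy'0, mul_zero]
  · -- orientation-preserving case `|β| < |α|`
    rw [polarSq_apply_of_lt hlt] at hy
    simp only [← hα] at hy
    have hα0 : α ≠ 0 := by
      rintro h0
      rw [h0, norm_zero] at hlt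
      exact absurd hlt (not_lt.2 (norm_nonneg β))
    set r : ℝ := ‖α‖ with hr
    have hr0 : (r : ℂ) ≠ 0 := by exact_mod_cast (norm_ne_zero_iff.2 hα0)
    set om := α / (r : ℂ) with hom
    have hαom : α = (r : ℂ) * om := by rw [hom]; field_simp
    have homn : ‖om‖ = 1 := by
      rw [hom, norm_div, Complex.norm_real, Real.norm_eq_abs, hr, abs_norm,
        div_self (norm_ne_zero_iff.2 hα0)]
    have hom0 : om ≠ 0 := fun h0 => by rw [h0, norm_zero] at homn; exact zero_ne_one homn
    have hconjom : conj om = om⁻¹ := by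
      refine eq_inv_of_mul_eq_one_left ?_
      rw [mul_comm, Complex.mul_conj, Complex.normSq_eq_norm_sq, homn]; simp
    -- the substitution `ε = om e`, `v = om y'`, `S x = r x + β om x̄`
    obtain ⟨ε, hε⟩ : ∃ ε : ℂ, ε = om * e := ⟨_, rfl⟩
    obtain ⟨v, hv⟩ : ∃ v : ℂ, v = om * y' := ⟨_, rfl⟩
    have heε : e = om⁻¹ * ε := by rw [hε, ← mul_assoc, inv_mul_cancel₀ hom0, one_mul]
    have hy'v : y' = om⁻¹ * v := by rw [hv, ← mul_assoc, inv_mul_cancel₀ hom0, one_mul]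
    have hS : ∀ x : ℂ, (r - ‖β‖) * ‖x‖ ^ 2 ≤ (conj x * ((r : ℂ) * x + (β * om) * conj x)).re :=
      fun x => by
        have h := re_conj_mul_add_ge r (β * om) x
        rwa [norm_mul, homn, mul_one] at h
    have hεp : 0 < (conj ε * ((r : ℂ) * ε + (β * om) * conj ε)).re := by
      have h := hS ε
      have hεn : ‖ε‖ = 1 := by rw [hε, norm_mul, he, homn, mul_one]
      rw [hεn] at h
      have : 0 < r - ‖β‖ := sub_pos.2 hlt
      nlinarith
    have hv0 : v = 0 := by
      refine eq_zero_of_pos_of_rel (a := a) (t := t) (c := r - ‖β‖) hεp (sub_pos.2 hlt) (hS v)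
        ha ht hat ?_
      have key : (a : ℂ) * (ε * v) + t * (((r : ℂ) * ε + (β * om) * conj ε) *
          ((r : ℂ) * v + (β * om) * conj v)) =
          (a : ℂ) * (om ^ 2 * y) + t * ((α * e + β * conj e) * (α * y' + β * conj y')) := by
        rw [hyy, hαom, heε, hy'v]
        simp only [map_mul, map_inv₀, hconjom, inv_inv]
        field_simp
      rw [key]
      exact hy
    have hy'0 : y' = 0 := by rw [hy'v, hv0, mul_zero]
    rw [hyy, hy'0, mul_zero]

/-! ### First-order consequences of `flipIm`-equivariance and of preserving the real locus -/

/-- A map commuting with `flipIm` near a real point takes a real value there: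
`(θ (u, 0)).2 = 0`. [folklore] -/
theorem snd_apply_eq_zero_of_equivariant {θ : 𝕄 → 𝕄} {u : Fin 2 → ℝ}
    (heq : ∀ᶠ x in 𝓝 ((u, 0) : 𝕄), θ (flipIm x) = flipIm (θ x)) : (θ (u, 0)).2 = 0 := by
  have h := heq.self_of_nhds
  have h0 : flipIm ((u, 0) : 𝕄) = (u, 0) := by simp
  rw [h0] at h
  have h2 := congrArg Prod.snd h
  simp only [flipIm_apply] at h2
  -- `θ₂ = -θ₂`
  linear_combination h2 / 2

/-- **The derivative of a `flipIm`-equivariant map at a real point commutes with `flipIm`.**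
[folklore] -/
theorem fderiv_comp_flipIm_of_equivariant {θ : 𝕄 → 𝕄} {u : Fin 2 → ℝ} {θ' : 𝕄 →L[ℝ] 𝕄}
    (hθ : HasFDerivAt θ θ' (u, 0))
    (heq : ∀ᶠ x in 𝓝 ((u, 0) : 𝕄), θ (flipIm x) = flipIm (θ x)) :
    θ'.comp (flipIm : 𝕄 →L[ℝ] 𝕄) = (flipIm : 𝕄 →L[ℝ] 𝕄).comp θ' := by
  have h0 : flipIm ((u, 0) : 𝕄) = (u, 0) := by simp
  -- both sides are derivatives at `(u, 0)` of the same germ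
  have h1 : HasFDerivAt (θ ∘ flipIm) (θ'.comp (flipIm : 𝕄 →L[ℝ] 𝕄)) (u, 0) := by
    have hθ' : HasFDerivAt θ θ' (flipIm ((u, 0) : 𝕄)) := by rw [h0]; exact hθ
    exact hθ'.comp _ (flipIm : 𝕄 ≃L[ℝ] 𝕄).hasFDerivAt
  have h2 : HasFDerivAt (flipIm ∘ θ) ((flipIm : 𝕄 →L[ℝ] 𝕄).comp θ') (u, 0) :=
    (flipIm : 𝕄 ≃L[ℝ] 𝕄).hasFDerivAt.comp _ hθ
  have hflip : Tendsto (flipIm : 𝕄 → 𝕄) (𝓝 ((u, 0) : 𝕄)) (𝓝 ((u, 0) : 𝕄)) := by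
    have := (flipIm : 𝕄 ≃L[ℝ] 𝕄).continuous.tendsto ((u, 0) : 𝕄)
    rwa [h0] at this
  have h3 : (θ ∘ flipIm) =ᶠ[𝓝 ((u, 0) : 𝕄)] (flipIm ∘ θ) := by
    filter_upwards [heq] with x hx
    exact hx
  exact h1.unique (h2.congr_of_eventuallyEq h3)

/-- For a `flipIm`-equivariant map, **real tangent vectors are sent to real vectors**:
`(θ' (a, 0)).2 = 0`. [folklore] -/
theorem snd_fderiv_inl_eq_zero_of_equivariant {θ : 𝕄 → 𝕄} {u : Fin 2 → ℝ} {θ' : 𝕄 →L[ℝ] 𝕄}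
    (hθ : HasFDerivAt θ θ' (u, 0))
    (heq : ∀ᶠ x in 𝓝 ((u, 0) : 𝕄), θ (flipIm x) = flipIm (θ x)) (a : Fin 2 → ℝ) :
    (θ' (a, 0)).2 = 0 := by
  have h := congrArg (fun A : 𝕄 →L[ℝ] 𝕄 => (A (a, 0)).2) (fderiv_comp_flipIm_of_equivariant hθ heq)
  simp only [ContinuousLinearMap.coe_comp, Function.comp_apply, ContinuousLinearEquiv.coe_coe,
    flipIm_apply, neg_zero] at h
  linear_combination h / 2

/-- For a `flipIm`-equivariant map, **normal vectors are sent to normal vectors**: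
`(θ' (0, b)).1 = 0`. [folklore] -/
theorem fst_fderiv_inr_eq_zero_of_equivariant {θ : 𝕄 → 𝕄} {u : Fin 2 → ℝ} {θ' : 𝕄 →L[ℝ] 𝕄}
    (hθ : HasFDerivAt θ θ' (u, 0))
    (heq : ∀ᶠ x in 𝓝 ((u, 0) : 𝕄), θ (flipIm x) = flipIm (θ x)) (b : ℂ) :
    (θ' (0, b)).1 = 0 := by
  have h := congrArg (fun A : 𝕄 →L[ℝ] 𝕄 => (A (0, b)).1) (fderiv_comp_flipIm_of_equivariant hθ heq)
  simp only [ContinuousLinearMap.coe_comp, Function.comp_apply, ContinuousLinearEquiv.coe_coe,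
    flipIm_apply] at h
  have h' : θ' ((0 : Fin 2 → ℝ), -b) = -θ' (0, b) := by
    rw [← map_neg]; congr 1; simp
  rw [h'] at h
  simp only [Prod.fst_neg] at h
  -- `-x = x` in a real vector space
  have h2 : (2 : ℝ) • (θ' (0, b)).1 = 0 := by
    rw [two_smul]
    nth_rewrite 1 [← h]
    simp
  exact (smul_eq_zero.1 h2).resolve_left two_ne_zero

/-- **A map constant along the real locus has derivative vanishing on real vectors**: if
`f (u', 0) = c` for `u'` near `u` and `f` is differentiable at `(u, 0)` then `f' (a, 0) = 0`.
(Applied to the normal component of a map preserving the branch locus.) [folklore] -/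
theorem fderiv_inl_eq_zero_of_eventually_const {F : Type*} [NormedAddCommGroup F]
    [NormedSpace ℝ F] {f : 𝕄 → F} {u : Fin 2 → ℝ} {f' : 𝕄 →L[ℝ] F} {c : F}
    (hf : HasFDerivAt f f' (u, 0)) (hc : ∀ᶠ u' in 𝓝 u, f (u', 0) = c) (a : Fin 2 → ℝ) :
    f' (a, 0) = 0 := by
  -- the restriction `u' ↦ f (u', 0)` has derivative `f' ∘ inl` and is eventually constant
  have hi : HasFDerivAt (fun u' : Fin 2 → ℝ => ((u', 0) : 𝕄))
      (ContinuousLinearMap.inl ℝ (Fin 2 → ℝ) ℂ) u :=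
    (ContinuousLinearMap.inl ℝ (Fin 2 → ℝ) ℂ).hasFDerivAt.congr_of_eventuallyEq
      (Eventually.of_forall fun u' => by simp)
  have h1 : HasFDerivAt (fun u' : Fin 2 → ℝ => f (u', 0))
      (f'.comp (ContinuousLinearMap.inl ℝ (Fin 2 → ℝ) ℂ)) u := hf.comp u hi
  have h2 : HasFDerivAt (fun u' : Fin 2 → ℝ => f (u', 0)) (0 : (Fin 2 → ℝ) →L[ℝ] F) u :=
    (hasFDerivAt_const c u).congr_of_eventuallyEq hc
  have := h1.unique h2
  have h3 := congrArg (fun A : (Fin 2 → ℝ) →L[ℝ] F => A a) this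
  simpa using h3

end BranchedModel

end Literature.Topology.FourManifolds

end
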